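import Summits.QuantumAdvantage.AdviceFreeQNC0.CrossFreeWindowFibre
import Summits.QuantumAdvantage.AdviceFreeQNC0.TwistBoundX3LocalProof
import Summits.QuantumAdvantage.AdviceFreeQNC0.WindowLocalHard
import Summits.QuantumAdvantage.AdviceFreeQNC0.WalkTransport
import Summits.QuantumAdvantage.AdviceFreeQNC0.TwoBlindSpotsFlip
import HarnessLib

/-!
# Cell qa-qnc0, `p = 3` — the windowed main terms `RingWindowLocalLt3` / `RingWindowLocalPolyLt3` PROVED,
# hence the rung R-lin3 ⊗ R-loc `RingLinFormsLocalLt3`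

Planner qa-qnc0-p1 g20 (ask P-20e, `exp20/Sketch20x.lean` §6/§8; typed VERBATIM in `BondTwistLocal.lean`):

* **`ringWindowLocalLt3 : RingWindowLocalLt3`** — bells that are `r`-local INSIDE a window of `L ≥ L₀(r)` letters and
  otherwise ARBITRARY functions of the letters outside it win the ring game on at most `θ₀·2^{N−1}` patterns of the odd
  class; here `θ₀ < 1` is even INDEPENDENT of `r` (the `θ` of the cross-free window theorem);
* **`ringWindowLocalPolyLt3 : RingWindowLocalPolyLt3`** — the same with `r ≤ (log₂ N)^C` and a window of length
  `L ≥ N/(log₂ N)^C`, all large `N`;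
* **`ringLinFormsLocalLt3 : RingLinFormsLocalLt3`** — the RUNG R-lin3 ⊗ R-loc (bells = per-cut tables of `K ≤ (log₂N)^C`
  linear forms mod 3 AND the radius-`r` window at the cut), via `TwistBoundX3LocalProof.ringLinFormsLocalLt3_of_window`.

## Proof (`card_oddRel_windowLocal_le`)

Transport to walk coordinates (`WalkTransport.rel_iff_ringWinU`, charge `n + 2`, `N = n + 1`): the transported selector is
`y_g(u) = t_g(xOfU u)` (the canonical guesses cancel), and letter `x_j` reads the walk bits `u_{j−1}, u_j` only
(`xOfU_congr_at`).  Inside the letter window `[a, a+L)` place the walk window `[p, p+W)`, `p = a + r`,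
`W = B + (r+1) + B`, so that `r` walk bits remain on either side (`q ≥ r`; this absorbs the cyclic wrap-around of
`CycNear`, `RegisterChainLocal.cycNear_cases`).  On every outside fibre `(A, B')` all letters outside `[a, a+L)` are
frozen, so EVERY selector `y_g` restricted to the fibre reads only the `≤ 2r + 2` window bits `u_{g−r−1}, …, u_{g+r}`
(`dependsOn_fibre`) and has `𝔽₂`-degree `≤ 2r + 2` there (junta lemma `ind_mem_lowDeg_of_dependsOn`) — whatever its
dependence on the outside letters; and the window `[p, p+B) ++ [p+B, p+B+r+1) ++ [p+B+r+1, p+W)` is CROSS-FREE (a bell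
strictly inside the first block is at cyclic distance `> r` from every letter touching the third).  The fibre-degree
cross-free window theorem `CrossFreeWindowFibre.ringWinU_crossFree_sqrt_le_fibre` (`B ≥ n₀`, `2r + 2 ≤ c₁√B`) bounds the
walk wins by `θ·2ⁿ`, and the odd class injects into them (`xOfU_uVec`).

WHAT THIS IS NOT: `θ₀` is the unoptimised constant of the cross-cell obstruction, not the conjectured `2/3`; the polylog
rung `RingLinFormsLocalPolyLt3` still needs its glue (with `TwistBoundX3LocalQ`); crux 22907 untouched; no separation.

References: S. Srinivasan, *A robust version of Hegedűs's lemma, with applications*, TheoretiCS 2 (2023), Lemma 3.1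
[Srinivasan2023] (through `ringWinU_crossFree_sqrt_le_fibre`).
-/

noncomputable section

namespace Summit.QuantumAdvantage.AdviceFreeQNC0

open Finset Literature.Computability.QuantumComplexity Literature.Computability.QuantumComplexity.RingHLF
open Literature.Computability.MetaComplexity Literature.Computability.MetaComplexity.Smolensky

namespace BondTwist3

namespace WindowLocalLt3

variable {n : ℕ}

/-! ### Letters read two walk bits -/

/-- Letter `j` of `xOfU u` depends on the walk bits `u_{j−1}, u_j` only. -/
theorem xOfU_congr_at (u u' : Fin n → Bool) (j : Fin (n + 1))
    (h : ∀ m : Fin n, (m.val = j.val ∨ m.val + 1 = j.val) → u m = u' m) : xOfU u j = xOfU u' j := by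
  have e1 : uExt u j.val = uExt u' j.val := by
    unfold uExt
    split_ifs with hj
    · exact h ⟨j.val, hj⟩ (Or.inl rfl)
    · rfl
  have e2 : j.val ≠ 0 → uExt u (j.val - 1) = uExt u' (j.val - 1) := by
    intro hj0
    unfold uExt
    split_ifs with hj
    · exact h ⟨j.val - 1, hj⟩ (Or.inr (by simp only; omega))
    · rfl
  unfold xOfU
  by_cases hj0 : j.val = 0
  · rw [if_pos hj0, if_pos hj0, e1]
  · rw [if_neg hj0, if_neg hj0, e1, e2 hj0]

/-! ### The layout: letter window `[a, a+L)`, walk window `[p, p+W)` with `p = a + r`, `r` spare bits on the right -/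

section Layout

variable {p W q r a L : ℕ}

/-- **Which letters can see a walk bit.**  If `u_m` (`m` a walk index) influences letter `j` (`m ∈ {j−1, j}`) and letter
`j` is read by bell `g` of a window-local rule (outside `[a, a+L)`, or cyclically `r`-near `g`), then — given the margins
`a + r ≤ p`, `p + W + r ≤ n`, `p + W < a + L` — either `m` lies outside the walk window `[p, p+W)` or
`g − r − 1 ≤ m ≤ g + r` (straight line, no wrap-around). -/
theorem read_cases (hp : a + r ≤ p) (hq : r ≤ q) (hW : p + W < a + L) {j g : Fin (p + W + q + 1)}
    (hj : (j.val < a ∨ a + L ≤ j.val) ∨ CycNear (p + W + q + 1) r j g) {m : ℕ} (hm : m = j.val ∨ m + 1 = j.val)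
    (hmid : p ≤ m ∧ m < p + W) : g.val ≤ m + (r + 1) ∧ m ≤ g.val + r := by
  have hjlt := j.isLt
  have hglt := g.isLt
  rcases hj with hout | hnear
  · exfalso; omega
  · rcases cycNear_cases hnear with hst | hw1 | hw2 <;> omega

/-- The walk bits a fibre-restricted selector can read, `S_g = {i < W : g − r − 1 ≤ p + i ≤ g + r}`, are `≤ 2r + 2`. -/
theorem card_readSet_le (p W r g : ℕ) :
    (univ.filter fun i : Fin W => g ≤ p + i.val + (r + 1) ∧ p + i.val ≤ g + r).card ≤ 2 * r + 2 := by
  calc (univ.filter fun i : Fin W => g ≤ p + i.val + (r + 1) ∧ p + i.val ≤ g + r).card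
      ≤ (Finset.range (2 * r + 2)).card := by
        refine Finset.card_le_card_of_injOn (fun i => p + i.val + (r + 1) - g) ?_ ?_
        · intro i hi
          rw [Finset.mem_coe, mem_filter] at hi
          rw [Finset.mem_coe, Finset.mem_range]
          show p + i.val + (r + 1) - g < 2 * r + 2
          omega
        · intro i hi i' hi' h
          rw [Finset.mem_coe, mem_filter] at hi hi'
          have h' : p + i.val + (r + 1) - g = p + i'.val + (r + 1) - g := h
          exact Fin.ext (by omega)
    _ = 2 * r + 2 := Finset.card_range _

end Layout

section Fibre

variable {p W q r a L : ℕ} {t : Fin (p + W + q + 1) → (Fin (p + W + q + 1) → Bool) → Bool}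

/-- **Fibre dependence.**  On the outside fibre `(A, B')` the restricted selector `w ↦ y_g(A ++ w ++ B')` depends only on
the coordinates in `S_g`. -/
theorem dependsOn_fibre (hp : a + r ≤ p) (hq : r ≤ q) (hW : p + W < a + L)
    (ht : ∀ (x x' : Fin (p + W + q + 1) → Bool) (k : Fin (p + W + q + 1)),
      (∀ j : Fin (p + W + q + 1), (j.val < a ∨ a + L ≤ j.val) ∨ CycNear (p + W + q + 1) r j k → x j = x' j) →
        t k x = t k x')
    (g : Fin (p + W + q + 1)) (A : Fin p → Bool) (B' : Fin q → Bool) (w w' : Fin W → Bool)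
    (hww : ∀ i ∈ (univ.filter fun i : Fin W => g.val ≤ p + i.val + (r + 1) ∧ p + i.val ≤ g.val + r), w i = w' i) :
    t g (xOfU (glue3 A w B')) = t g (xOfU (glue3 A w' B')) := by
  refine ht _ _ g fun j hj => xOfU_congr_at _ _ j fun m hm => ?_
  by_cases hmid : p ≤ m.val ∧ m.val < p + W
  · rw [glue3_apply_mid A w B' m hmid.1 hmid.2, glue3_apply_mid A w' B' m hmid.1 hmid.2]
    have hrc := read_cases hp hq hW hj hm hmid
    exact hww _ (by rw [mem_filter]; exact ⟨mem_univ _, by simp only; omega, by simp only; omega⟩)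
  · rcases Nat.lt_or_ge m.val p with h1 | h1
    · rw [glue3_apply_lt A w B' m h1, glue3_apply_lt A w' B' m h1]
    · have h2 : p + W ≤ m.val := by omega
      rw [glue3_apply_ge A w B' m h2, glue3_apply_ge A w' B' m h2]

/-- **Fibre degree `≤ 2r + 2`.** -/
theorem hasDeg_fibre (hp : a + r ≤ p) (hq : r ≤ q) (hW : p + W < a + L)
    (ht : ∀ (x x' : Fin (p + W + q + 1) → Bool) (k : Fin (p + W + q + 1)),
      (∀ j : Fin (p + W + q + 1), (j.val < a ∨ a + L ≤ j.val) ∨ CycNear (p + W + q + 1) r j k → x j = x' j) →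
        t k x = t k x')
    (g : Fin (p + W + q + 1)) (A : Fin p → Bool) (B' : Fin q → Bool) :
    HasDeg (fun w : Fin W → Bool => t g (xOfU (glue3 A w B'))) (2 * r + 2) := by
  classical
  unfold HasDeg
  have h := ind_mem_lowDeg_of_dependsOn (F := ZMod 2)
    (univ.filter fun i : Fin W => g.val ≤ p + i.val + (r + 1) ∧ p + i.val ≤ g.val + r)
    (fun w : Fin W → Bool => t g (xOfU (glue3 A w B')))
    (fun w w' hww => dependsOn_fibre hp hq hW ht g A B' w w' hww)
  exact lowDeg_mono (card_readSet_le p W r g.val) h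

end Fibre

/-! ### Cross-freeness of the three blocks `[p, p+B) ++ [p+B, p+B+r+1) ++ [p+B+r+1, p+W)` -/

section CrossFree

variable {p B q r a L : ℕ} {t : Fin (p + (B + (r + 1) + B) + q + 1) → (Fin (p + (B + (r + 1) + B) + q + 1) → Bool) → Bool}

/-- Bells strictly inside the first block do not read the third block. -/
theorem crossFree_x (hp : a + r ≤ p) (hW : p + (B + (r + 1) + B) < a + L)
    (ht : ∀ (x x' : Fin (p + (B + (r + 1) + B) + q + 1) → Bool) (k : Fin (p + (B + (r + 1) + B) + q + 1)),
      (∀ j : Fin (p + (B + (r + 1) + B) + q + 1), (j.val < a ∨ a + L ≤ j.val) ∨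
        CycNear (p + (B + (r + 1) + B) + q + 1) r j k → x j = x' j) → t k x = t k x')
    (g : Fin (p + (B + (r + 1) + B) + q + 1)) (h1 : p < g.val) (h2 : g.val < p + B)
    (A : Fin p → Bool) (xb : Fin B → Bool) (h : Fin (r + 1) → Bool) (z z' : Fin B → Bool) (B' : Fin q → Bool) :
    t g (xOfU (glue3 A (glue3 xb h z) B')) = t g (xOfU (glue3 A (glue3 xb h z') B')) := by
  refine ht _ _ g fun j hj => xOfU_congr_at _ _ j fun m hm => glue3_glue3_eq_off_z A xb h z z' B' m ?_
  rintro ⟨hm1, hm2⟩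
  have hjlt := j.isLt
  rcases hj with hout | hnear
  · omega
  · rcases cycNear_cases hnear with hst | hw1 | hw2 <;> omega

/-- Bells strictly inside the third block do not read the first block. -/
theorem crossFree_z (hp : a + r ≤ p) (hW : p + (B + (r + 1) + B) < a + L)
    (ht : ∀ (x x' : Fin (p + (B + (r + 1) + B) + q + 1) → Bool) (k : Fin (p + (B + (r + 1) + B) + q + 1)),
      (∀ j : Fin (p + (B + (r + 1) + B) + q + 1), (j.val < a ∨ a + L ≤ j.val) ∨
        CycNear (p + (B + (r + 1) + B) + q + 1) r j k → x j = x' j) → t k x = t k x')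
    (g : Fin (p + (B + (r + 1) + B) + q + 1)) (h1 : p + (B + (r + 1)) < g.val) (h2 : g.val < p + (B + (r + 1) + B))
    (A : Fin p → Bool) (xb xb' : Fin B → Bool) (h : Fin (r + 1) → Bool) (z : Fin B → Bool) (B' : Fin q → Bool) :
    t g (xOfU (glue3 A (glue3 xb h z) B')) = t g (xOfU (glue3 A (glue3 xb' h z) B')) := by
  refine ht _ _ g fun j hj => xOfU_congr_at _ _ j fun m hm => glue3_glue3_eq_off_x A xb xb' h z B' m ?_
  rintro ⟨hm1, hm2⟩
  have hjlt := j.isLt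
  rcases hj with hout | hnear
  · omega
  · rcases cycNear_cases hnear with hst | hw1 | hw2 <;> omega

end CrossFree

/-! ### Transport: the odd class injects into the walk wins of `y` -/

open scoped Classical in
/-- `#{x odd : Rel x (tGuess ⊕ t)} ≤ #{u : WIN_y(u)}` at charge `n + 2` (`rel_iff_ringWinU`, `xOfU_uVec`). -/
theorem card_odd_le_card_win (hn : 2 ≤ n) (t : Fin (n + 1) → (Fin (n + 1) → Bool) → Bool) :
    (univ.filter fun x : Fin (n + 1) → Bool =>
        OddZeros x ∧ RingHLF.Rel x (fun k => xor (tGuess x k) (t k x))).card ≤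
      (univ.filter fun u : Fin n → Bool => ringWinU (n + 2) (fun g u => t g (xOfU u)) u = true).card := by
  classical
  set z : (Fin (n + 1) → Bool) → (Fin (n + 1) → Bool) := fun x k => xor (tGuess x k) (t k x) with hz
  have hy' : (fun (g : Fin (n + 1)) (u : Fin n → Bool) => xor (z (xOfU u) g) (tGuess (xOfU u) g)) =
      fun g u => t g (xOfU u) := by
    funext g u
    simp only [hz]
    generalize tGuess (xOfU u) g = b
    generalize t g (xOfU u) = d
    cases b <;> cases d <;> rfl
  refine Finset.card_le_card_of_injOn uVec ?_ ?_
  · intro x hx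
    rw [Finset.mem_coe, mem_filter] at hx
    rw [Finset.mem_coe, mem_filter]
    refine ⟨mem_univ _, ?_⟩
    have h := (rel_iff_ringWinU hn x hx.2.1 z).1 hx.2.2
    rwa [hy'] at h
  · intro x₁ hx₁ x₂ hx₂ h
    rw [Finset.mem_coe, mem_filter] at hx₁ hx₂
    have e1 := xOfU_uVec hn x₁ hx₁.2.1
    have e2 := xOfU_uVec hn x₂ hx₂.2.1
    rw [← e1, ← e2, h]

/-! ### The core bound -/

open scoped Classical in
/-- **Core bound (explicit layout).**  With the constants `θ, c₁, n₀` of the fibre-degree cross-free window theorem: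
for every radius `r` and block length `B ≥ n₀` with `2r + 2 ≤ c₁√B`, every letter window `[a, a+L)` with
`L ≥ 2B + 3r + 2`, `a + L ≤ N`, and every bell rule that is `r`-local inside the window and otherwise an arbitrary
function of the letters outside it, the odd-class win count is `≤ θ·2^{N−1}`. -/
theorem card_oddRel_windowLocal_le :
    ∃ θ : ℝ, θ < 1 ∧ ∃ c₁ : ℝ, 0 < c₁ ∧ ∃ n₀ : ℕ, ∀ r B : ℕ, n₀ ≤ B → ((2 * r + 2 : ℕ) : ℝ) ≤ c₁ * Real.sqrt B →
      ∀ N a L : ℕ, 2 * B + 3 * r + 2 ≤ L → a + L ≤ N →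
      ∀ t : Fin N → (Fin N → Bool) → Bool,
        (∀ (x x' : Fin N → Bool) (k : Fin N),
            (∀ j : Fin N, (j.val < a ∨ a + L ≤ j.val) ∨ CycNear N r j k → x j = x' j) → t k x = t k x') →
          ((univ.filter fun x : Fin N → Bool =>
              OddZeros x ∧ RingHLF.Rel x (fun k => xor (tGuess x k) (t k x))).card : ℝ)
            ≤ θ * (2 : ℝ) ^ (N - 1) := by
  classical
  obtain ⟨θ, hθ, c₁, hc₁, n₀, H⟩ := ringWinU_crossFree_sqrt_le_fibre
  refine ⟨θ, hθ, c₁, hc₁, n₀, fun r B hB hD N a L hL haL t ht => ?_⟩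
  -- `B ≥ 1` (from `2 ≤ c₁√B`), so `N ≥ 4`
  have hB1 : 1 ≤ B := by
    by_contra h0
    have hB0 : B = 0 := by omega
    rw [hB0, Nat.cast_zero, Real.sqrt_zero, mul_zero] at hD
    have : (0 : ℝ) < ((2 * r + 2 : ℕ) : ℝ) := by positivity
    linarith
  obtain ⟨n, rfl⟩ : ∃ n, N = n + 1 := ⟨N - 1, by omega⟩
  -- layout: `n = p + W + q`, `p = a + r`, `W = B + (r+1) + B`, `q ≥ r`
  obtain ⟨q, rfl⟩ : ∃ q, n = (a + r) + (B + (r + 1) + B) + q :=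
    ⟨n - ((a + r) + (B + (r + 1) + B)), by omega⟩
  have hq : r ≤ q := by omega
  have hW : (a + r) + (B + (r + 1) + B) < a + L := by omega
  rw [Nat.add_sub_cancel]
  refine le_trans ?_ (H (a + r) B (r + 1) B q hB hB (2 * r + 2) hD hD ((a + r) + (B + (r + 1) + B) + q + 2)
    (fun g u => t g (xOfU u)) ?_ ?_ ?_)
  · exact_mod_cast card_odd_le_card_win (by omega) t
  · intro g A B'
    exact hasDeg_fibre (p := a + r) (W := B + (r + 1) + B) (q := q) le_rfl hq hW ht g A B'
  · intro g h1 h2 A xb h z z' B'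
    exact crossFree_x le_rfl hW ht g h1 h2 A xb h z z' B'
  · intro g h1 h2 A xb xb' h z B'
    exact crossFree_z le_rfl hW ht g h1 h2 A xb xb' h z B'

end WindowLocalLt3

open WindowLocalLt3

/-! ### The main terms and the rung -/

/-- `2r + 2 ≤ c₁ √B` for `B ≥ ⌈((2r+2)/c₁)²⌉`. -/
private theorem deg_le_sqrt {c₁ : ℝ} (hc₁ : 0 < c₁) (r : ℕ) {B : ℕ} (hB : ⌈(((2 * r + 2 : ℕ) : ℝ) / c₁) ^ 2⌉₊ ≤ B) :
    ((2 * r + 2 : ℕ) : ℝ) ≤ c₁ * Real.sqrt B := by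
  have h1 : (((2 * r + 2 : ℕ) : ℝ) / c₁) ^ 2 ≤ (B : ℝ) := (Nat.le_ceil _).trans (by exact_mod_cast hB)
  have h0 : (0 : ℝ) ≤ ((2 * r + 2 : ℕ) : ℝ) / c₁ := by positivity
  have h2 : ((2 * r + 2 : ℕ) : ℝ) / c₁ ≤ Real.sqrt B := by
    rw [← Real.sqrt_sq h0]; exact Real.sqrt_le_sqrt h1
  calc ((2 * r + 2 : ℕ) : ℝ) = c₁ * (((2 * r + 2 : ℕ) : ℝ) / c₁) := by field_simp
    _ ≤ c₁ * Real.sqrt B := mul_le_mul_of_nonneg_left h2 hc₁.le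

/-- **`ringWindowLocalLt3 : RingWindowLocalLt3` — PROVED** (`θ₀` independent of `r`; `L₀(r) = 2B(r) + 3r + 2`). -/
theorem ringWindowLocalLt3 : RingWindowLocalLt3 := by
  classical
  intro r
  obtain ⟨θ, hθ, c₁, hc₁, n₀, H⟩ := card_oddRel_windowLocal_le
  set B : ℕ := max n₀ ⌈(((2 * r + 2 : ℕ) : ℝ) / c₁) ^ 2⌉₊ with hBdef
  refine ⟨θ, hθ, 2 * B + 3 * r + 2, fun N a L hL haL t ht => ?_⟩
  exact H r B (le_max_left _ _) (deg_le_sqrt hc₁ r (le_max_right _ _)) N a L hL haL t ht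

/-- **`ringLinFormsLocalLt3 : RingLinFormsLocalLt3` — the rung R-lin3 ⊗ R-loc, PROVED** (constant radius `r`; bells =
per-cut tables of `K ≤ (log₂ N)^C` linear forms mod 3 and the radius-`r` window at the cut). -/
theorem ringLinFormsLocalLt3 : RingLinFormsLocalLt3 :=
  ringLinFormsLocalLt3_of_window ringWindowLocalLt3

/-! ### The polylog-radius main term -/

/-- Room: for large `N`, `(2·B(N) + 3 (log₂N)^C + 2)·(log₂ N)^C ≤ N` with `B(N) = n₀ + ⌈((2(log₂N)^C+2)/c₁)²⌉`. -/
private theorem poly_room {c₁ : ℝ} (hc₁ : 0 < c₁) (n₀ C : ℕ) : ∃ n₁ : ℕ, ∀ N ≥ n₁,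
    (2 * (n₀ + ⌈(((2 * Nat.log 2 N ^ C + 2 : ℕ) : ℝ) / c₁) ^ 2⌉₊) + 3 * Nat.log 2 N ^ C + 2) * Nat.log 2 N ^ C ≤ N := by
  -- everything is `≤ K · (log₂ N)^{3C}` for a constant `K`; then `logPow_le_sqrt'`
  set K : ℝ := 2 * (n₀ + (16 / c₁ ^ 2 + 1)) + 3 + 2 with hK
  have hKpos : 0 < K := by positivity
  obtain ⟨n₂, hn₂⟩ := logPow_le_sqrt' (3 * C) (c₀ := 1 / K) (by positivity)
  refine ⟨max n₂ 4, fun N hN => ?_⟩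
  have hN4 : 4 ≤ N := le_trans (le_max_right _ _) hN
  have hn₂N : n₂ ≤ N := le_trans (le_max_left _ _) hN
  set k := Nat.log 2 N with hk
  have hk2 : 2 ≤ k := Nat.le_log_of_pow_le (by norm_num) hN4
  have hk1r : (1 : ℝ) ≤ (k : ℝ) := by exact_mod_cast (by omega : 1 ≤ k)
  have hk1 : (1 : ℝ) ≤ (k : ℝ) ^ C := one_le_pow₀ hk1r
  have hkC0 : (0 : ℝ) ≤ (k : ℝ) ^ C := by positivity
  have h5 : (1 : ℝ) ≤ (k : ℝ) ^ (2 * C) := one_le_pow₀ hk1r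
  have h6 : (k : ℝ) ^ C ≤ (k : ℝ) ^ (2 * C) := pow_le_pow_right₀ hk1r (by omega)
  -- `(log N)^{3C} ≤ √N / K ≤ N / K`
  have hroom : ((k ^ (3 * C) : ℕ) : ℝ) ≤ 1 / K * Real.sqrt N := hn₂ N hn₂N
  have hsqrt : Real.sqrt N ≤ N := by
    have hN1 : (1 : ℝ) ≤ N := by exact_mod_cast (le_trans (by norm_num) hN4)
    calc Real.sqrt N ≤ Real.sqrt N * Real.sqrt N :=
          le_mul_of_one_le_right (Real.sqrt_nonneg _) (by rw [← Real.sqrt_one]; exact Real.sqrt_le_sqrt hN1)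
      _ = N := Real.mul_self_sqrt (by positivity)
  have hKr : K * (k : ℝ) ^ (3 * C) ≤ (N : ℝ) := by
    have hkC3 : ((k ^ (3 * C) : ℕ) : ℝ) = (k : ℝ) ^ (3 * C) := by push_cast; ring
    rw [hkC3] at hroom
    have := mul_le_mul_of_nonneg_left hroom hKpos.le
    rw [← mul_assoc, mul_one_div_cancel hKpos.ne', one_mul] at this
    exact this.trans hsqrt
  -- the ceiling term `X ≤ (16/c₁² + 1)·k^{2C}`
  have hceil : ((⌈(((2 * k ^ C + 2 : ℕ) : ℝ) / c₁) ^ 2⌉₊ : ℕ) : ℝ) ≤ (16 / c₁ ^ 2 + 1) * (k : ℝ) ^ (2 * C) := by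
    have h1 : ((⌈(((2 * k ^ C + 2 : ℕ) : ℝ) / c₁) ^ 2⌉₊ : ℕ) : ℝ) < (((2 * k ^ C + 2 : ℕ) : ℝ) / c₁) ^ 2 + 1 :=
      Nat.ceil_lt_add_one (by positivity)
    have h3 : ((2 * k ^ C + 2 : ℕ) : ℝ) ≤ 4 * (k : ℝ) ^ C := by push_cast; linarith
    have h4 : ((2 * k ^ C + 2 : ℕ) : ℝ) ^ 2 ≤ (4 * (k : ℝ) ^ C) ^ 2 := pow_le_pow_left₀ (by positivity) h3 2
    have e2 : (k : ℝ) ^ (2 * C) = ((k : ℝ) ^ C) ^ 2 := pow_mul' _ _ _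
    have h2 : (((2 * k ^ C + 2 : ℕ) : ℝ) / c₁) ^ 2 ≤ 16 / c₁ ^ 2 * (k : ℝ) ^ (2 * C) := by
      rw [div_pow, e2]
      calc ((2 * k ^ C + 2 : ℕ) : ℝ) ^ 2 / c₁ ^ 2 ≤ (4 * (k : ℝ) ^ C) ^ 2 / c₁ ^ 2 :=
            div_le_div_of_nonneg_right h4 (by positivity)
        _ = 16 / c₁ ^ 2 * ((k : ℝ) ^ C) ^ 2 := by ring
    nlinarith
  -- assemble in `ℝ` with the ceiling generalized away
  have hmain : (((2 * (n₀ + ⌈(((2 * k ^ C + 2 : ℕ) : ℝ) / c₁) ^ 2⌉₊) + 3 * k ^ C + 2) * k ^ C : ℕ) : ℝ) ≤ (N : ℝ) := by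
    generalize hX : ⌈(((2 * k ^ C + 2 : ℕ) : ℝ) / c₁) ^ 2⌉₊ = X at hceil ⊢
    push_cast
    have e3 : (k : ℝ) ^ (3 * C) = (k : ℝ) ^ (2 * C) * (k : ℝ) ^ C := by
      rw [show 3 * C = 2 * C + C by ring, pow_add]
    have hn0 : (n₀ : ℝ) ≤ n₀ * (k : ℝ) ^ (2 * C) := by
      have := mul_le_mul_of_nonneg_left h5 (Nat.cast_nonneg n₀)
      rwa [mul_one] at this
    calc (2 * ((n₀ : ℝ) + (X : ℝ)) + 3 * (k : ℝ) ^ C + 2) * (k : ℝ) ^ C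
        ≤ (2 * ((n₀ : ℝ) * (k : ℝ) ^ (2 * C) + (16 / c₁ ^ 2 + 1) * (k : ℝ) ^ (2 * C)) + 3 * (k : ℝ) ^ (2 * C) +
            2 * (k : ℝ) ^ (2 * C)) * (k : ℝ) ^ C := by
          refine mul_le_mul_of_nonneg_right ?_ hkC0
          linarith
      _ = K * (k : ℝ) ^ (3 * C) := by rw [hK, e3]; ring
      _ ≤ N := hKr
  exact_mod_cast hmain

/-- **`ringWindowLocalPolyLt3 : RingWindowLocalPolyLt3` — PROVED** (radius `r ≤ (log₂ N)^C`, window `L ≥ N/(log₂ N)^C`). -/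
theorem ringWindowLocalPolyLt3 : RingWindowLocalPolyLt3 := by
  classical
  obtain ⟨θ, hθ, c₁, hc₁, n₀, H⟩ := card_oddRel_windowLocal_le
  refine ⟨θ, hθ, fun C => ?_⟩
  obtain ⟨n₁, hn₁⟩ := poly_room hc₁ n₀ C
  refine ⟨max n₁ 2, fun N hN r hr a L hNL haL t ht => ?_⟩
  have hN2 : 2 ≤ N := le_trans (le_max_right _ _) hN
  set k := Nat.log 2 N with hk
  set B : ℕ := n₀ + ⌈(((2 * k ^ C + 2 : ℕ) : ℝ) / c₁) ^ 2⌉₊ with hBdef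
  have hroom := hn₁ N (le_trans (le_max_left _ _) hN)
  -- `L ≥ 2B + 3r + 2`: from `N ≤ L·k^C` and the room inequality
  have hk1 : 1 ≤ k := Nat.le_log_of_pow_le (by norm_num) (by simpa using hN2)
  have hkC : 0 < k ^ C := Nat.one_le_pow _ _ hk1
  have hL : 2 * B + 3 * r + 2 ≤ L := by
    have h1 : (2 * B + 3 * r + 2) * k ^ C ≤ (2 * B + 3 * k ^ C + 2) * k ^ C :=
      Nat.mul_le_mul_right _ (by omega)
    have h2 : (2 * B + 3 * r + 2) * k ^ C ≤ L * k ^ C := le_trans (le_trans h1 hroom) hNL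
    exact Nat.le_of_mul_le_mul_right h2 hkC
  have hD : ((2 * r + 2 : ℕ) : ℝ) ≤ c₁ * Real.sqrt B := by
    have h1 : ((2 * r + 2 : ℕ) : ℝ) ≤ ((2 * k ^ C + 2 : ℕ) : ℝ) := by
      exact_mod_cast (by omega : 2 * r + 2 ≤ 2 * k ^ C + 2)
    exact h1.trans (deg_le_sqrt hc₁ (k ^ C) (B := B) (by omega))
  exact H r B (by omega) hD N a L hL haL t ht

end BondTwist3

end Summit.QuantumAdvantage.AdviceFreeQNC0

end
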